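import Mathlib
import Summits.Ventures.DiscreteObjects.Mahler.Height1CensusCells

/-!
# The explicit list of the 53 admissible cells of the height-1 census up to degree 60
(venture `DiscreteObjects`, target L)

Cell `pub-namedobj`, seat `pub-namedobj-mahler` (gen 6). Framing: lottery ticket; floor = certified
bounds/negative ranges.

`Height1CensusCells.lean` reduces "no integer polynomial of degree `≤ 60` and height `≤ 1` is
sub-Lehmer" to the cells `Height1Cell s d` over all `AdmissibleCell s d` (a `∀` over multisets).  Here the
admissible index set is made EXPLICIT: it is the list `admissibleCellList` of `53` pairs `(s, d)`
(`admissibleCell_iff_mem`: case analysis on `|s| ≤ 4`, each concrete case kernel-decided), so that the census statement becomes the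
conjunction of `53` named cell statements (`height1_subLehmer_empty_le_60_of_cellList`) — one per
CORES / offset run of the cell's engines (file `CELLS-L60.md`; runs human-gated, none performed here).
-/

namespace Summit.Ventures.DiscreteObjects.Mahler

open Polynomial Literature.NumberTheory.MahlerMeasure

/-- The admissible cyclotomic indices `{1,2,3,4,5,6,8,10,12}` (those with `φ ≤ 4`). -/
def cellIndexSet : Finset ℕ := {1, 2, 3, 4, 5, 6, 8, 10, 12}

/-- The 53 admissible cells `(s, d)` (cofactor multiset as a list, core degree), ordered by total
degree `Σ φ(s) + d = 56, …, 60`. -/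
def admissibleCellListRaw : List (List ℕ × ℕ) :=
  [([], 56), ([1], 56), ([2], 56), ([3], 56), ([4], 56), ([6], 56), ([1, 1], 56), ([1, 2], 56),
   ([2, 2], 56), ([], 58), ([1, 3], 56), ([1, 4], 56), ([1, 6], 56), ([2, 3], 56), ([2, 4], 56),
   ([2, 6], 56), ([1, 1, 1], 56), ([1, 1, 2], 56), ([1, 2, 2], 56), ([2, 2, 2], 56), ([1], 58),
   ([2], 58), ([5], 56), ([8], 56), ([10], 56), ([12], 56), ([3, 3], 56), ([3, 4], 56),
   ([3, 6], 56), ([4, 4], 56), ([4, 6], 56), ([6, 6], 56), ([1, 1, 3], 56), ([1, 1, 4], 56),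
   ([1, 1, 6], 56), ([1, 2, 3], 56), ([1, 2, 4], 56), ([1, 2, 6], 56), ([2, 2, 3], 56),
   ([2, 2, 4], 56), ([2, 2, 6], 56), ([1, 1, 1, 1], 56), ([1, 1, 1, 2], 56), ([1, 1, 2, 2], 56),
   ([1, 2, 2, 2], 56), ([2, 2, 2, 2], 56), ([3], 58), ([4], 58), ([6], 58), ([1, 1], 58),
   ([1, 2], 58), ([2, 2], 58), ([], 60)]

/-- The admissible cells as (multiset, degree) pairs. -/
def admissibleCellList : List (Multiset ℕ × ℕ) :=
  admissibleCellListRaw.map fun p => ((p.1 : Multiset ℕ), p.2)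

/-- The list has `53` entries. -/
theorem admissibleCellList_length : admissibleCellList.length = 53 := by decide

/-- Every listed cell is admissible (kernel-decided). -/
theorem admissible_of_mem : ∀ p ∈ admissibleCellList, AdmissibleCell p.1 p.2 := by
  unfold AdmissibleCell
  decide +kernel

/-- The indices with `φ ≤ 2` (kernel-decided on the nine candidates). -/
theorem small_of_totient_le_two : ∀ m ∈ cellIndexSet, Nat.totient m ≤ 2 →
    m = 1 ∨ m = 2 ∨ m = 3 ∨ m = 4 ∨ m = 6 := by decide

/-- The indices with `φ ≤ 1` (kernel-decided on the nine candidates). -/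
theorem small_of_totient_le_one : ∀ m ∈ cellIndexSet, Nat.totient m ≤ 1 → m = 1 ∨ m = 2 := by decide

/-- `φ(m) ≥ 1` on the index set. -/
theorem one_le_totient_of_mem {m : ℕ} (hm : m ∈ cellIndexSet) : 1 ≤ Nat.totient m := by
  have : 0 < m := by simp only [cellIndexSet, Finset.mem_insert, Finset.mem_singleton] at hm; omega
  exact Nat.totient_pos.mpr this

/-- For `m ∈ s`: `φ(m) + (|s| - 1) ≤ Σ φ(s)` (all other indices contribute `≥ 1`). -/
theorem totient_add_card_le_sum {s : Multiset ℕ} (hs : ∀ m ∈ s, m ∈ cellIndexSet) {m : ℕ} (hm : m ∈ s) :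
    Nat.totient m + (Multiset.card s - 1) ≤ (s.map Nat.totient).sum := by
  obtain ⟨t, rfl⟩ := Multiset.exists_cons_of_mem hm
  have h1 : ∀ x ∈ t.map Nat.totient, 1 ≤ x := by
    intro x hx
    obtain ⟨m', hm', rfl⟩ := Multiset.mem_map.mp hx
    exact one_le_totient_of_mem (hs m' (Multiset.mem_cons_of_mem hm'))
  have hcard := Multiset.card_nsmul_le_sum h1
  rw [Multiset.card_map, smul_eq_mul, mul_one] at hcard
  rw [Multiset.map_cons, Multiset.sum_cons, Multiset.card_cons]
  omega

/-- In an admissible cell the cofactor multiset has at most `4` elements. -/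
theorem card_le_four_of_admissible {s : Multiset ℕ} {d : ℕ} (h : AdmissibleCell s d) :
    Multiset.card s ≤ 4 := by
  obtain ⟨hs, hd, hsum⟩ := h
  rcases Multiset.empty_or_exists_mem s with h0 | ⟨m, hm⟩
  · simp [h0]
  · have := totient_add_card_le_sum hs hm
    have := one_le_totient_of_mem (hs m hm)
    omega

/-- **The admissible cells are exactly the listed ones** (case analysis on `|s| ≤ 4`; each of the
finitely many concrete cases is kernel-decided). -/
theorem admissibleCell_iff_mem (s : Multiset ℕ) (d : ℕ) :
    AdmissibleCell s d ↔ (s, d) ∈ admissibleCellList := by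
  constructor
  · intro h
    have hk := card_le_four_of_admissible h
    obtain ⟨hs, hd, hsum⟩ := h
    have hmemS : ∀ m ∈ s, m = 1 ∨ m = 2 ∨ m = 3 ∨ m = 4 ∨ m = 5 ∨ m = 6 ∨ m = 8 ∨ m = 10 ∨ m = 12 := by
      intro m hm
      have := hs m hm
      simpa only [cellIndexSet, Finset.mem_insert, Finset.mem_singleton] using this
    -- elements are further restricted when |s| ≥ 3 resp. = 4
    have hsmall2 : 3 ≤ Multiset.card s → ∀ m ∈ s, m = 1 ∨ m = 2 ∨ m = 3 ∨ m = 4 ∨ m = 6 := by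
      intro h3 m hm
      have := totient_add_card_le_sum hs hm
      exact small_of_totient_le_two m (hs m hm) (by omega)
    have hsmall1 : 4 ≤ Multiset.card s → ∀ m ∈ s, m = 1 ∨ m = 2 := by
      intro h4 m hm
      have := totient_add_card_le_sum hs hm
      exact small_of_totient_le_one m (hs m hm) (by omega)
    interval_cases hk' : Multiset.card s
    · -- |s| = 0
      have : s = 0 := Multiset.card_eq_zero.mp hk'
      subst this
      rcases hd with rfl | rfl | rfl <;> decide
    · -- |s| = 1
      obtain ⟨a, rfl⟩ := Multiset.card_eq_one.mp hk'
      have ha := hmemS a (by simp)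
      revert hsum
      rcases hd with rfl | rfl | rfl <;>
        rcases ha with rfl | rfl | rfl | rfl | rfl | rfl | rfl | rfl | rfl <;> decide
    · -- |s| = 2
      obtain ⟨a, b, rfl⟩ := Multiset.card_eq_two.mp hk'
      have ha := hmemS a (by simp)
      have hb := hmemS b (by simp)
      revert hsum
      rcases hd with rfl | rfl | rfl <;>
        rcases ha with rfl | rfl | rfl | rfl | rfl | rfl | rfl | rfl | rfl <;>
          rcases hb with rfl | rfl | rfl | rfl | rfl | rfl | rfl | rfl | rfl <;> decide
    · -- |s| = 3
      obtain ⟨a, b, c, rfl⟩ := Multiset.card_eq_three.mp hk'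
      have ha := hsmall2 (by omega) a (by simp)
      have hb := hsmall2 (by omega) b (by simp)
      have hc := hsmall2 (by omega) c (by simp)
      revert hsum
      rcases hd with rfl | rfl | rfl <;>
        rcases ha with rfl | rfl | rfl | rfl | rfl <;> rcases hb with rfl | rfl | rfl | rfl | rfl <;>
          rcases hc with rfl | rfl | rfl | rfl | rfl <;> decide
    · -- |s| = 4
      obtain ⟨a, ha⟩ := Multiset.card_pos_iff_exists_mem.mp (by omega : 0 < Multiset.card s)
      obtain ⟨t, rfl⟩ := Multiset.exists_cons_of_mem ha
      have ht : Multiset.card t = 3 := by rw [Multiset.card_cons] at hk'; omega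
      obtain ⟨b, c, e, rfl⟩ := Multiset.card_eq_three.mp ht
      have ha' := hsmall1 (by omega) a (by simp)
      have hb := hsmall1 (by omega) b (by simp)
      have hc := hsmall1 (by omega) c (by simp)
      have he := hsmall1 (by omega) e (by simp)
      revert hsum
      rcases hd with rfl | rfl | rfl <;>
        rcases ha' with rfl | rfl <;> rcases hb with rfl | rfl <;> rcases hc with rfl | rfl <;>
          rcases he with rfl | rfl <;> decide
  · intro h
    exact admissible_of_mem (s, d) h

/-- **Assembly over the explicit list (kernel):** conditional on [MRW08, Thm 1.1] and Smyth's theorem,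
the `53` cell statements `Height1Cell s d`, `(s, d) ∈ admissibleCellList`, imply that no integer
polynomial of degree `≤ 60` and height `≤ 1` is sub-Lehmer. -/
theorem height1_subLehmer_empty_le_60_of_cellList (h : SubLehmerDegreeBound)
    (hS : NonreciprocalMahlerBound) (hcells : ∀ p ∈ admissibleCellList, Height1Cell p.1 p.2) :
    ∀ P : ℤ[X], P.natDegree ≤ 60 → height P ≤ 1 → ¬ SubLehmer P :=
  height1_subLehmer_empty_le_60_of_cells h hS fun s d hsd =>
    hcells (s, d) ((admissibleCell_iff_mem s d).mp hsd)

end Summit.Ventures.DiscreteObjects.Mahler
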